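import Summits.Ventures.PercRepro.ProfilePointedCircuitClassesTwelveSeriesB

/-!
# PercRepro — THE SERIES-PAIR REDUCTION OF THE TWELVE-POINT STATEMENT, III: THE ELEVEN-POINT STATEMENT `(★)`, ITS
SERIES-TWIN CASE, AND THE SERIES-TRIPLE REGIME (p5, gen 44; `proofs/P5-GM1.md` §66)

* `StarEleven α` (a CONJECTURE def, NOT asserted): on every coloop-free matroid with `11` points and rank `6` and every
  two distinct points `e, f`, `in_5(e) ≤ in_5(f) + thru_5({e, f})` — the bi-independent `5`-sets through `e` avoiding
  `f` are at most those through `f`.  Census (own exact code, §66): 0 failures on ≈ 60,000 ordered pairs.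
* `star_of_seriesPair`: `(★)` HOLDS when `f` has a series twin `g ≠ e` — every bi-independent `5`-set contains at most
  one of `f, g`; the sets `W ∋ e, g` swap to sets `W ∋ e, f` (`card_filter_swap_of_seriesPair`), and the sets
  `W ∋ e` avoiding `f, g` inject into the bi-independent `6`-sets `W + g ∋ e` avoiding `f` (`g ∉ cl(W)`), which are
  the complements of the `5`-sets through `f` avoiding `e`.
* `inCount_five_le_outCount_six_of_seriesPair_of_starEleven`: the twelve-point statement at `(N, e)` for every
  coloop-free `N` with a series pair avoiding `e`, MODULO `StarEleven`.
* **`inCount_five_le_outCount_six_of_seriesTriple`** (UNCONDITIONAL): the twelve-point statement at `(N, e)` whenever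
  `N` has a series class of three points `a, a', a''` avoiding `e` (two series pairs `{a, a'}`, `{a', a''}`): the
  minor `N ／ a` still has the series pair `{a', a''}`, so `(★)` holds there by `star_of_seriesPair`.
-/

open scoped Matroid

namespace PercRepro.Cogirth

open Finset ThmH Skew Shadow Profile

variable {α : Type} [DecidableEq α] {N : Matroid α} [N.Finite]

section TwelveSeriesC

/-- **THE ELEVEN-POINT TWO-POINT INEQUALITY `(★)`** (a CONJECTURE def, NOT asserted, carried as a hypothesis): on every
coloop-free matroid with `11` points and rank `6`, for every two distinct points `e, f`,
`in_5(e) ≤ in_5(f) + thru_5({e, f})`. -/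
def StarEleven (α : Type) [DecidableEq α] : Prop :=
  ∀ (N : Matroid α) [N.Finite] (e f : α), e ∈ gr N → f ∈ gr N → e ≠ f → (gr N).card = 11 →
    rk N (gr N) = 6 → (∀ x ∈ gr N, rk N ((gr N).erase x) = rk N (gr N)) →
    inCount N 5 e ≤ inCount N 5 f + thruCount N 5 {e, f}

/-- **MIXED TWO-POINT COMPLEMENTATION**: the bi-independent `k`-sets containing `p` but not `q` are as many as the
bi-independent `(n − k)`-sets containing `q` but not `p` (`X ↦ E ∖ X`). -/
theorem card_filter_sdiff_mixed_eq {M : Matroid α} [M.Finite] {k : ℕ} {p q : α} (hp : p ∈ gr M) (hq : q ∈ gr M)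
    (hk : k ≤ (gr M).card) :
    ((biIndepSets M k).filter (fun S => p ∈ S ∧ q ∉ S)).card =
      ((biIndepSets M ((gr M).card - k)).filter (fun W => p ∉ W ∧ q ∈ W)).card := by
  apply card_bij (fun X _ => gr M \ X)
  · intro X hX
    rw [mem_filter] at hX ⊢
    exact ⟨sdiff_mem_biIndepSets hX.1, fun h => (mem_sdiff.1 h).2 hX.2.1, mem_sdiff.2 ⟨hq, hX.2.2⟩⟩
  · intro X₁ hX₁ X₂ hX₂ heq
    have h₁ : X₁ ⊆ gr M := (mem_biIndepSets.1 (mem_filter.1 hX₁).1).1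
    have h₂ : X₂ ⊆ gr M := (mem_biIndepSets.1 (mem_filter.1 hX₂).1).1
    rw [← Finset.sdiff_sdiff_eq_self h₁, ← Finset.sdiff_sdiff_eq_self h₂, heq]
  · intro Y hY
    rw [mem_filter] at hY
    have hYg : Y ⊆ gr M := (mem_biIndepSets.1 hY.1).1
    refine ⟨gr M \ Y, ?_, Finset.sdiff_sdiff_eq_self hYg⟩
    rw [mem_filter]
    refine ⟨?_, mem_sdiff.2 ⟨hp, hY.2.1⟩, fun h => (mem_sdiff.1 h).2 hY.2.2⟩
    have := sdiff_mem_biIndepSets hY.1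
    rwa [Nat.sub_sub_self hk] at this

/-- **THE INJECTION `W ↦ W + g`**: the bi-independent `k`-sets with a property `P` avoiding a series pair `{f, g}` are
at most the bi-independent `(k+1)`-sets with `P` avoiding `f` (`g ∉ cl(W)`, and the complement shrinks). -/
theorem card_filter_le_card_filter_insert_of_seriesPair {f g : α} (h : SeriesPair N f g) (k : ℕ)
    (P : Finset α → Prop) [DecidablePred P] (hP : ∀ W, P (insert g W) ↔ P W) :
    ((biIndepSets N k).filter (fun W => (P W ∧ f ∉ W) ∧ g ∉ W)).card ≤
      ((biIndepSets N (k + 1)).filter (fun X => P X ∧ f ∉ X)).card := by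
  have hg : g ∈ gr N := h.2.1
  have hne : f ≠ g := h.2.2.1
  apply card_le_card_of_injOn (fun W => insert g W)
  · intro W hW
    rw [mem_coe, mem_filter] at hW
    obtain ⟨hWb, ⟨hPW, hfW⟩, hgW⟩ := hW
    obtain ⟨hWg, hWc, hWr, hWcompl⟩ := mem_biIndepSets.1 hWb
    have hY : W ⊆ ((gr N).erase f).erase g :=
      fun y hy => mem_erase.2 ⟨fun h' => hgW (h' ▸ hy), mem_erase.2 ⟨fun h' => hfW (h' ▸ hy), hWg hy⟩⟩
    have hgc : g ∈ gr N \ W := mem_sdiff.2 ⟨hg, hgW⟩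
    have hcompl : gr N \ insert g W = (gr N \ W).erase g := by
      ext y
      simp only [mem_sdiff, mem_insert, mem_erase, not_or, ne_eq]
      tauto
    rw [mem_coe, mem_filter, mem_biIndepSets]
    refine ⟨⟨insert_subset hg hWg, ?_, ?_, ?_⟩, (hP W).2 hPW,
      fun h' => (mem_insert.1 h').elim (fun h'' => hne h'') hfW⟩
    · rw [card_insert_of_notMem hgW, hWc]
    · rw [rk_insert_right_eq_add_one_of_seriesPair h hY, card_insert_of_notMem hgW, hWr]
    · rw [hcompl]
      exact rk_eq_card_of_subset_of_rk_eq_card (erase_subset _ _) hWcompl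
  · intro W₁ hW₁ W₂ hW₂ heq
    rw [mem_coe, mem_filter] at hW₁ hW₂
    have heq' : insert g W₁ = insert g W₂ := heq
    rw [← erase_insert hW₁.2.2, ← erase_insert hW₂.2.2, heq']

/-- **`(★)` HOLDS WHEN `f` HAS A SERIES TWIN**: on `#E = 11`, `ρ(E) = 6`, if `{f, g}` is a series pair and
`e ∉ {f, g}`, then `in_5(e) ≤ in_5(f) + thru_5({e, f})`.  Proof: `in_5(e) = A₂ + A₃ + A₄` with
`A₂ = #{W ∋ e, f ∌ g}`, `A₃ = #{W ∋ e, g ∌ f} = A₂` (the swap) and `A₄ = #{W ∋ e ∌ f, g} ≤ #{X ∈ BI_6 : e ∈ X, f ∉ X}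
= #{W ∋ f ∌ e}` (the injection `W ↦ W + g` and the complementation), while `thru_5({e, f}) = A₂` and
`in_5(f) = A₂ + #{W ∋ f ∌ e}` (no bi-independent `5`-set contains both `f` and `g`). -/
theorem star_of_seriesPair {e f g : α} (hn : (gr N).card = 11) (hR : rk N (gr N) = 6) (h : SeriesPair N f g)
    (he : e ∈ gr N) (hef : e ≠ f) (heg : e ≠ g) :
    inCount N 5 e ≤ inCount N 5 f + thruCount N 5 {e, f} := by
  have hf : f ∈ gr N := h.1
  have hn5 : (gr N).card = rk N (gr N) + 5 := by omega
  have hPe : ∀ W : Finset α, e ∈ insert g (W.erase f) ↔ e ∈ W := by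
    intro W
    rw [mem_insert, mem_erase]
    constructor
    · rintro (h' | ⟨_, h'⟩)
      · exact absurd h' heg
      · exact h'
    · intro h'
      exact Or.inr ⟨hef, h'⟩
  have hPe' : ∀ W : Finset α, e ∈ insert f (W.erase g) ↔ e ∈ W := by
    intro W
    rw [mem_insert, mem_erase]
    constructor
    · rintro (h' | ⟨_, h'⟩)
      · exact absurd h' hef
      · exact h'
    · intro h'
      exact Or.inr ⟨heg, h'⟩
  have hIg : ∀ W : Finset α, e ∈ insert g W ↔ e ∈ W := by
    intro W
    rw [mem_insert]
    exact ⟨fun h' => h'.resolve_left heg, fun h' => Or.inr h'⟩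
  -- the decomposition of `in_5(e)` by `f, g`
  have hD := card_filter_eq_sum_four (biIndepSets N 5) (fun W => e ∈ W) f g
  have hboth : ((biIndepSets N 5).filter (fun W => (e ∈ W ∧ f ∈ W) ∧ g ∈ W)).card = 0 := by
    rw [card_eq_zero, filter_eq_empty_iff]
    rintro W hW ⟨⟨_, hfW⟩, hgW⟩
    exact not_mem_of_mem_biIndepSets_of_seriesPair h hn5 hW hfW hgW
  have hswap := card_filter_swap_of_seriesPair h 5 (fun W => e ∈ W) hPe hPe'
  have hinj := card_filter_le_card_filter_insert_of_seriesPair h 5 (fun W => e ∈ W) hIg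
  simp only [Nat.reduceAdd] at hinj
  have hcompl := card_filter_sdiff_mixed_eq (M := N) (k := 6) he hf (by omega)
  rw [hn, show (11 : ℕ) - 6 = 5 by norm_num] at hcompl
  -- `thru_5({e, f})` and `in_5(f)`
  have hthru : thruCount N 5 {e, f} = ((biIndepSets N 5).filter (fun W => e ∈ W ∧ f ∈ W)).card := by
    unfold thruCount
    exact congrArg Finset.card (filter_congr (fun W _ => by rw [insert_subset_iff, singleton_subset_iff]))
  have hthru2 := card_filter_eq_sum_two (biIndepSets N 5) (fun W => e ∈ W ∧ f ∈ W) g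
  have hF := card_filter_eq_sum_two (biIndepSets N 5) (fun W => f ∈ W) e
  have hcomm : ((biIndepSets N 5).filter (fun W => f ∈ W ∧ e ∈ W)).card =
      ((biIndepSets N 5).filter (fun W => e ∈ W ∧ f ∈ W)).card :=
    congrArg Finset.card (filter_congr (fun W _ => and_comm))
  have hcomm' : ((biIndepSets N 5).filter (fun W => f ∈ W ∧ e ∉ W)).card =
      ((biIndepSets N 5).filter (fun W => e ∉ W ∧ f ∈ W)).card :=
    congrArg Finset.card (filter_congr (fun W _ => and_comm))
  unfold inCount at hF ⊢
  rw [hD, hboth, hthru, hthru2, hboth, hF, hcomm, hcomm', hthru2, hboth]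
  omega

/-- **THE TWELVE-POINT STATEMENT MODULO `(★)`**: on every coloop-free matroid with `12` points and rank `7` that has a
series pair `{a, a'}` avoiding `e`, `in_5(e) ≤ out_6(e)` follows from `StarEleven` (applied to `N ／ a`, `e`, `a'`). -/
theorem inCount_five_le_outCount_six_of_seriesPair_of_starEleven (hstar : StarEleven α)
    (hn : (gr N).card = 12) (hR : rk N (gr N) = 7) (hcf : ∀ x ∈ gr N, rk N ((gr N).erase x) = rk N (gr N))
    {a a' e : α} (h : SeriesPair N a a') (he : e ∈ gr N) (hea : e ≠ a) (hea' : e ≠ a') :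
    inCount N 5 e ≤ outCount N 6 e := by
  apply inCount_five_le_outCount_six_of_seriesPair_of_star hn hR h he hea hea'
  have hgr' : gr (N ／ ({a} : Set α)) = (gr N).erase a := gr_contract'
  have hind := indep_singleton_of_seriesPair h
  have hcard' : (gr (N ／ ({a} : Set α))).card = 11 := by rw [hgr', card_erase_of_mem h.1, hn]
  have hrk' : rk (N ／ ({a} : Set α)) (gr (N ／ ({a} : Set α))) = 6 := by
    have := rk_gr_contract_add_one hind h.1
    omega
  have hcf' : ∀ x ∈ gr (N ／ ({a} : Set α)),
      rk (N ／ ({a} : Set α)) ((gr (N ／ ({a} : Set α))).erase x) = rk (N ／ ({a} : Set α)) (gr (N ／ ({a} : Set α))) := by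
    intro x hx
    rw [hrk', hgr']
    rw [hgr'] at hx
    have hxa : a ≠ x := fun h' => (mem_erase.1 hx).1 h'.symm
    have h1 := rk_contract_add_one hind (erase_subset x ((gr N).erase a))
    rw [insert_erase_erase_eq_erase h.1 hxa, hcf x (mem_of_mem_erase hx)] at h1
    omega
  have he' : e ∈ gr (N ／ ({a} : Set α)) := by rw [hgr']; exact mem_erase.2 ⟨hea, he⟩
  have ha'' : a' ∈ gr (N ／ ({a} : Set α)) := by rw [hgr']; exact mem_erase.2 ⟨h.2.2.1.symm, h.2.1⟩
  exact hstar (N ／ ({a} : Set α)) e a' he' ha'' hea' hcard' hrk' hcf'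

/-- `(E − a − a') − a'' + a = (E − a') − a''`. -/
theorem insert_erase_erase_erase_eq_erase_erase {a a' a'' : α} (ha : a ∈ gr N) (haa' : a ≠ a') (haa'' : a ≠ a'') :
    insert a ((((gr N).erase a).erase a').erase a'') = ((gr N).erase a').erase a'' := by
  ext y
  simp only [mem_insert, mem_erase]
  constructor
  · rintro (rfl | ⟨hy'', hy', _, hyg⟩)
    · exact ⟨haa'', haa', ha⟩
    · exact ⟨hy'', hy', hyg⟩
  · rintro ⟨hy'', hy', hyg⟩
    by_cases hya : y = a
    · exact Or.inl hya
    · exact Or.inr ⟨hy'', hy', hya, hyg⟩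

/-- **A SERIES PAIR `{a', a''}` OF `N` SURVIVES IN `N ／ a`** (`a ∉ {a', a''}`, `a` itself in a series pair, so a
non-loop; `N` coloop-free is not needed: `a'`, `a''` are non-coloops of `N`). -/
theorem seriesPair_contract_of_seriesPair {a a' a'' : α} (h : SeriesPair N a a') (h' : SeriesPair N a' a'')
    (haa'' : a ≠ a'') : SeriesPair (N ／ ({a} : Set α)) a' a'' := by
  have hgr' : gr (N ／ ({a} : Set α)) = (gr N).erase a := gr_contract'
  have hind := indep_singleton_of_seriesPair h
  have hrk' := rk_gr_contract_add_one hind h.1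
  rw [hgr'] at hrk'
  refine ⟨?_, ?_, h'.2.2.1, ?_, ?_, ?_⟩
  · rw [hgr']; exact mem_erase.2 ⟨h.2.2.1.symm, h.2.1⟩
  · rw [hgr']; exact mem_erase.2 ⟨haa''.symm, h'.2.1⟩
  · rw [hgr']
    have h1 := rk_contract_add_one hind (erase_subset a' ((gr N).erase a))
    rw [insert_erase_erase_eq_erase h.1 h.2.2.1, h.2.2.2.2.1] at h1
    omega
  · rw [hgr']
    have h1 := rk_contract_add_one hind (erase_subset a'' ((gr N).erase a))
    rw [insert_erase_erase_eq_erase h.1 haa'', h'.2.2.2.2.1] at h1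
    omega
  · rw [hgr']
    have h1 := rk_contract_add_one hind
      (show (((gr N).erase a).erase a').erase a'' ⊆ (gr N).erase a from
        (erase_subset _ _).trans (erase_subset _ _))
    rw [insert_erase_erase_erase_eq_erase_erase h.1 h.2.2.1 haa''] at h1
    have h2 := h'.2.2.2.2.2
    omega

/-- **THE SERIES-TRIPLE REGIME OF THE TWELVE-POINT STATEMENT** (UNCONDITIONAL): on every matroid with `12` points and
rank `7` that has three points `a, a', a''` with `{a, a'}` and `{a', a''}` series pairs, `in_5(e) ≤ out_6(e)` at every
point `e ∉ {a, a', a''}`.  (In the dual: a parallel class of size `≥ 3` avoiding `e`.)  The minor `N ／ a` keeps the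
series pair `{a', a''}`, so `(★)` holds there by `star_of_seriesPair`, and the reduction closes. -/
theorem inCount_five_le_outCount_six_of_seriesTriple (hn : (gr N).card = 12) (hR : rk N (gr N) = 7)
    {a a' a'' e : α} (h : SeriesPair N a a') (h' : SeriesPair N a' a'') (haa'' : a ≠ a'')
    (he : e ∈ gr N) (hea : e ≠ a) (hea' : e ≠ a') (hea'' : e ≠ a'') :
    inCount N 5 e ≤ outCount N 6 e := by
  apply inCount_five_le_outCount_six_of_seriesPair_of_star hn hR h he hea hea'
  have hgr' : gr (N ／ ({a} : Set α)) = (gr N).erase a := gr_contract'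
  have hind := indep_singleton_of_seriesPair h
  have hcard' : (gr (N ／ ({a} : Set α))).card = 11 := by rw [hgr', card_erase_of_mem h.1, hn]
  have hrk' : rk (N ／ ({a} : Set α)) (gr (N ／ ({a} : Set α))) = 6 := by
    have := rk_gr_contract_add_one hind h.1
    omega
  have he' : e ∈ gr (N ／ ({a} : Set α)) := by rw [hgr']; exact mem_erase.2 ⟨hea, he⟩
  exact star_of_seriesPair hcard' hrk' (seriesPair_contract_of_seriesPair h h' haa'') he' hea' hea''

end TwelveSeriesC

end PercRepro.Cogirth
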